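import Summits.CriticalPhenomena.PercolationContinuityZ3.Theorems.Transplant.SkelPhiRootHoldsAll
import Summits.CriticalPhenomena.PercolationContinuityZ3.Theorems.Transplant.SkelPhiConcFaceHoldsAll
import Summits.CriticalPhenomena.PercolationContinuityZ3.Theorems.Transplant.SkelPhiConcReachHoldsAll
import Summits.CriticalPhenomena.PercolationContinuityZ3.Theorems.Transplant.PlanarSkeletonCriticalProbLtOne
import HarnessLib

/-!
# (Z‴) THE MULTI-TYPE D″ NODE HOLDS: **`samePDropOfSkeletonSign_holds : SamePDropOfSkeletonSign`** — Benjamini–Schramm's Conjecture 4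
# (`θ(p_c) = 0`) for EVERY connected graph carrying a `PlanarSkeletonSign` (two-axis reflectable planar skeleton with ANY finite set of base
# vertex types) under Φ2 at `p_c`, by OPTION C of the D″ programme (DPRIME-SCOPE addendum N.8/N.10): the multi-type choice function
# `signChoiceAll` (p3-g7 `SkelSignChoiceAll`, = stmt-g9's `signChoice₂` values with the one-type binder dropped), its well-formedness, and the
# three residues re-instantiated at the all-types premise `AtQAll` — (R) `rootHoldsFnAll_signChoiceAll` (p2-g9 `SkelPhiRootHoldsAll`), (F)
# `faceHoldsRFnAll_signChoiceAll` (`SkelPhiConcFaceHoldsAll`, hp-8 g30's one call), (C) `reachHoldsRHFnAll_signChoiceAll` (`SkelPhiConcReachHoldsAll`,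
# p5-g6's one call) — fed to `samePDropOfSkeletonSign_of_choiceFnAll` (p3-g7 `SkelSignChoiceRef`: Step I′ with one common band
# `Skelφ.exists_stepI_ref`, Hutchcroft, Burton–Keane, `p_c < 1`, the constants and the re-centring inside).  NODE-ONLY FILE (lead review
# 2026-08-21T08:46:32Z): besides the node, only its normal forms `PlanarSkeletonSign.criticalContinuity` (minimal form: no binder but Φ2 at `p_c`)
# and `PlanarSkeletonSign.criticalContinuity'` (every vertex, by frames); the multi-type CUSTOMERS (kagome □ ℤ, the `LineSkeletonNeg` product
# families) live in `SkelSignCustomersAll` filed right behind, and the weaker nodes follow by the landed implications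
# `samePDropOfSkeletonSign₁_of_sign` (p251543) / `samePDropOfSkeletonConcLt_of_sign` (p244708) — not restated here (files of record
# `SkelSign1Holds`, `SkelConcHolds`)

builds on p205010 (kernel theorem, internal audit signed; external expert review pending): the closure runs through near-one gluing
(`AdditiveGluing`), which builds on p205010.
Status sentence (coordinator 2026-08-20T04:30Z): "θ(p_c) = 0 on ℤ^d, all d ≥ 2 — kernel-verified (Lean 4/Mathlib, standard axioms); internal
adversarial audit SIGNED 2026-08-20 04:29Z; external expert review pending."
Lane `prim-bschramm-*`, seat `prim-bschramm-p3` (gen 8; D″ design owner); filed AFTER the single-type node `samePDropOfSkeletonSign₁_holds`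
(p1-g10 `SkelSign1Holds`) per the lead's node-level ruling 2026-08-21T07:20:22Z (second closing); helper file (`--supports stmt-CriticalPhenomena-4575`).
* **`samePDropOfSkeletonSign_holds`**, `PlanarSkeletonSign.criticalContinuity` (normal form at the base types), `PlanarSkeletonSign.criticalContinuity'`
  (every vertex).
[cite: KozmaNitzan2024, §4 Theorem 6 (pp. 25–31); §1 p. 2 (approach 1)] [cite: BenjaminiSchramm1996, Conj. 4]
-/

noncomputable section

open MeasureTheory
open scoped Classical

namespace Summit.CriticalPhenomena.PercolationContinuityZ3.Theorems.Transplant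

open Literature.Probability.Percolation Literature.Probability.LatticeModels SimpleGraph
open Literature.Barriers.CriticalPhenomena (countable_of_connected_of_locallyFinite)

/-! ## The node and its normal forms -/

/-- **THEOREM (Z‴, the multi-type D″ node): `SamePDropOfSkeletonSign` HOLDS** — for every connected, locally finite graph `G` with a
`PlanarSkeletonSign Φ` (any finite type set), every base type `t`, every `p < 1` with a.s. uniqueness, Φ2 and `θ_t(p) > 0`, there is `q < p` with
`θ_t(q) > 0`.  Proof: option C — `samePDropOfSkeletonSign_of_choiceFnAll signChoiceAll` with the well-formedness and the three all-types residues
(R) root, (F) faces, (C) corridors of the chosen two-unit Kozma–Nitzan scheme.  builds on p205010 (kernel theorem, internal audit signed; external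
expert review pending). [cite: KozmaNitzan2024, §4 Theorem 6 (pp. 25–31); §1 p. 2 (approach 1)] [cite: BenjaminiSchramm1996, Conj. 4] -/
theorem samePDropOfSkeletonSign_holds : SamePDropOfSkeletonSign :=
  PlanarSkeletonSign.samePDropOfSkeletonSign_of_choiceFnAll PlanarSkeletonSign.signChoiceAll PlanarSkeletonSign.wfHoldsFnAll_signChoiceAll
    PlanarSkeletonSign.rootHoldsFnAll_signChoiceAll PlanarSkeletonSign.faceHoldsRFnAll_signChoiceAll
    PlanarSkeletonSign.reachHoldsRHFnAll_signChoiceAll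

/-- **NORMAL FORM: `θ_t(p_c) = 0` at every base vertex of every `PlanarSkeletonSign` graph with subcritical cylinders at `p_c`** — connectedness,
countability, quasi-transitivity, uniqueness and `p_c < 1` are all supplied by the skeleton (`samePDropOfSkeletonSign_iff_minimal'`).
builds on p205010 (kernel theorem, internal audit signed; external expert review pending). [cite: BenjaminiSchramm1996, Conj. 4] [cite: Hutchcroft2016, Thm. 1] -/
theorem PlanarSkeletonSign.criticalContinuity {V : Type} (G : SimpleGraph V) [G.LocallyFinite] (Φ : PlanarSkeletonSign G) (t : V)
    (ht : t ∈ Φ.types) (hC : Φ.CylSubcritical (criticalProbIOf G t)) : theta G t (criticalProbIOf G t) = 0 :=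
  samePDropOfSkeletonSign_iff_minimal'.1 samePDropOfSkeletonSign_holds G Φ t ht hC

/-- **… at EVERY vertex** (every vertex is a frame image of a base vertex), given Φ2 at `p_c` of every base type.
builds on p205010 (kernel theorem, internal audit signed; external expert review pending). [cite: BenjaminiSchramm1996, Conj. 4] -/
theorem PlanarSkeletonSign.criticalContinuity' {V : Type} (G : SimpleGraph V) [G.LocallyFinite] (Φ : PlanarSkeletonSign G)
    (hC : ∀ t ∈ Φ.types, Φ.CylSubcritical (criticalProbIOf G t)) (v : V) : theta G v (criticalProbIOf G v) = 0 := by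
  haveI : Countable V := countable_of_connected_of_locallyFinite G (Φ.toPlanarSkeletonNeg.graph_connected v) v
  obtain ⟨t, ht, α, hαv, -⟩ := Φ.frame v
  have hbase : theta G t (criticalProbIOf G t) = 0 := PlanarSkeletonSign.criticalContinuity G Φ t ht (hC t ht)
  have hθ := theta_iso α t (criticalProbIOf G t)
  have hpc := criticalProb_iso α t
  rw [hαv] at hθ hpc
  have e : criticalProbIOf G v = criticalProbIOf G t := Subtype.ext hpc
  rw [e, hθ]
  exact hbase

end Summit.CriticalPhenomena.PercolationContinuityZ3.Theorems.Transplant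

end
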